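import Mathlib

/-!
# `NoHeavyLowerTail` (stmt-CriticalPhenomena-4575) — certificate machine, part 1:
# a kernel-evaluable checker for polynomial (Positivstellensatz / LP) certificates on cell laws

Support file (depth prover nh-dp-blobmono gen 3; `--supports stmt-CriticalPhenomena-4575`).  Computable
definitions and their soundness; no named facts, no sorries, standard axioms.

SETTING.  The certificate searches of the CIL / one-cut line (this unit's `job_deg3`, the engine and coupling
seats' LPs) prove a target inequality `μ(L) ≤ max_v μ(U_v)` between probabilities of connection events of a
few terminals from VALID PRODUCT ROWS `μ(E₁) μ(E₂) ≤ μ(E₃) μ(E₄)` (instances of tree lemmas) by exhibiting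
nonnegative multipliers: in the cell variables `x_c = μ(cell c)` (every event is a sum of cells),
`Σ_a w_a · m_a(x) · (L(x) − U_{ref a}(x)) + Σ_r w_r · m_r(x) · (E₃E₄ − E₁E₂)_r(x)` has all monomial coefficients
`≤ 0` (`m_a`, `m_r` monomials, `w ≥ 0` integers).  The monolithic `linear_combination` replay of such an
identity (≈ 2·10⁴ raw monomials for the first customer H5) is rejected by the kernel (memory), so the identity
is checked here REFLECTIVELY: the certificate is data (`Row`, `ATerm`), `check` expands both sides into term
lists, sorts (fuel merge sort) and groups them, and tests coefficientwise DOMINATION of the "plus" side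
(`L`-parts and `E₃E₄`-parts) by the "minus" side (`U`-parts and `E₁E₂`-parts) — all by structural recursion,
so that `decide` evaluates it in the kernel (`checkB`: the same restricted to one BUCKET of monomials, one
declaration per bucket, since the kernel's memory is per declaration — the full H5 certificate, 22 222 raw terms,
passes in 8 buckets in ≈ 2 min).  This file: the data, the checker, the values `evalM` / `evalT` / `linEval` and the
invariance of the value under sorting and grouping.  The soundness theorems (`CertCheck.sound`,
`CertCheck.sound_of_buckets`, `CertCheck.exists_le_of_sound`) are in `…CertCheckSound.lean`; part 2 (`…CertCells`)
instantiates `x` with the pattern-cell law of five terminals.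
-/

namespace Summit.CriticalPhenomena.PercolationContinuityZ3.Theorems

namespace CertCheck

/-! ## Data and the computable checker -/

/-- A term: a monomial (list of variable indices, with repetitions) with a natural coefficient. [folklore] -/
abbrev Term := List ℕ × ℕ

/-- A product row `E₁ E₂ ≤ E₃ E₄` (events as lists of cell indices) used with monomial multiplier `mult`
and weight `wt`. [folklore] -/
structure Row where
  /-- cells of `E₁` -/
  e1 : List ℕ
  /-- cells of `E₂` -/
  e2 : List ℕ
  /-- cells of `E₃` -/
  e3 : List ℕ
  /-- cells of `E₄` -/
  e4 : List ℕ
  /-- monomial multiplier -/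
  mult : List ℕ
  /-- nonnegative integer weight -/
  wt : ℕ
  deriving DecidableEq, Repr

/-- A target multiplier term `wt · mult · (L − U_ref)`. [folklore] -/
structure ATerm where
  /-- index of the reference event `U_ref` -/
  ref : ℕ
  /-- monomial multiplier -/
  mult : List ℕ
  /-- nonnegative integer weight -/
  wt : ℕ
  deriving DecidableEq, Repr

/-- Lexicographic comparison of monomials (used only to sort; irrelevant for soundness). [folklore] -/
def monoLE : List ℕ → List ℕ → Bool
  | [], _ => true
  | _ :: _, [] => false
  | a :: l, b :: l' => bif Nat.blt a b then true else bif Nat.beq a b then monoLE l l' else false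

/-- Insert a variable into a monomial (keeping sorted monomials sorted). [folklore] -/
def monoIns (a : ℕ) : List ℕ → List ℕ
  | [] => [a]
  | b :: l => bif Nat.ble a b then a :: b :: l else b :: monoIns a l

/-- Alternating split of a list. [folklore] -/
def split : List Term → List Term × List Term
  | [] => ([], [])
  | t :: l => (t :: (split l).2, (split l).1)

/-- Merge with fuel (structural in the fuel; when the fuel runs out the rest is appended). [folklore] -/
def mergeF : ℕ → List Term → List Term → List Term
  | 0, l₁, l₂ => l₁ ++ l₂
  | _ + 1, [], l₂ => l₂
  | _ + 1, t₁ :: l₁, [] => t₁ :: l₁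
  | f + 1, t₁ :: l₁, t₂ :: l₂ =>
    bif monoLE t₁.1 t₂.1 then t₁ :: mergeF f l₁ (t₂ :: l₂) else t₂ :: mergeF f (t₁ :: l₁) l₂

/-- Merge sort with fuel (structural in the fuel). [folklore] -/
def msortF : ℕ → List Term → List Term
  | 0, l => l
  | _ + 1, [] => []
  | _ + 1, [t] => [t]
  | f + 1, t :: t' :: l =>
    mergeF (l.length + 2) (msortF f (split (t :: t' :: l)).1) (msortF f (split (t :: t' :: l)).2)

/-- Group ADJACENT terms with equal monomials (accumulator form, structural). [folklore] -/
def groupAux : Term → List Term → List Term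
  | c, [] => [c]
  | c, t :: l => bif decide (c.1 = t.1) then groupAux (c.1, c.2 + t.2) l else c :: groupAux t l

/-- Group adjacent equal monomials. [folklore] -/
def group : List Term → List Term
  | [] => []
  | t :: l => groupAux t l

/-- Sort and group a term list. [folklore] -/
def normalize (l : List Term) : List Term := group (msortF l.length l)

/-- Find the first term with monomial `m`, returning its coefficient and the remaining tail. [folklore] -/
def dropTo (m : List ℕ) : List Term → Option (ℕ × List Term)
  | [] => none
  | t :: l => bif decide (t.1 = m) then some (t.2, l) else dropTo m l

/-- Coefficientwise domination test of a grouped sorted term list by another (a merge walk). [folklore] -/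
def dominated : List Term → List Term → Bool
  | [], _ => true
  | t :: l, g =>
    match dropTo t.1 g with
    | none => Nat.beq t.2 0 && dominated l g
    | some (c, g') => Nat.ble t.2 c && dominated l g'

/-- The terms `wt · (x_i x_j · mult)` for `i ∈ e`, `j ∈ e'` (expansion of `wt · mult · E E'`). [folklore] -/
def pairTerms (e e' mult : List ℕ) (wt : ℕ) : List Term :=
  e.flatMap fun i => e'.map fun j => (monoIns i (monoIns j mult), wt)

/-- The terms `wt · (x_i · mult)` for `i ∈ e` (expansion of `wt · mult · E`). [folklore] -/
def linTerms (e mult : List ℕ) (wt : ℕ) : List Term := e.map fun i => (monoIns i mult, wt)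

/-- The "plus" side: `Σ_a w_a m_a L + Σ_r w_r m_r E₃E₄`. [folklore] -/
def plusTerms (L : List ℕ) (rows : List Row) (al : List ATerm) : List Term :=
  (al.flatMap fun a => linTerms L a.mult a.wt) ++ rows.flatMap fun r => pairTerms r.e3 r.e4 r.mult r.wt

/-- The "minus" side: `Σ_a w_a m_a U_{ref a} + Σ_r w_r m_r E₁E₂`. [folklore] -/
def minusTerms (U : ℕ → List ℕ) (rows : List Row) (al : List ATerm) : List Term :=
  (al.flatMap fun a => linTerms (U a.ref) a.mult a.wt) ++ rows.flatMap fun r => pairTerms r.e1 r.e2 r.mult r.wt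

/-- THE CHECK: the plus side is dominated coefficientwise by the minus side. [folklore] -/
def check (L : List ℕ) (U : ℕ → List ℕ) (rows : List Row) (al : List ATerm) : Bool :=
  dominated (normalize (plusTerms L rows al)) (normalize (minusTerms U rows al))

/-- Bucket of a term: the sum of its variable indices modulo `nb` (any function of the monomial would do;
this one is permutation-invariant and spreads the cells evenly). [folklore] -/
def bucket (nb : ℕ) (t : Term) : ℕ := t.1.sum % nb

/-- THE BUCKETED CHECK for bucket `b`: domination restricted to the terms of bucket `b`.  Large certificates
are checked one bucket per declaration (the kernel's memory is per declaration); see `sound_of_buckets`.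
[folklore] -/
def checkB (nb b : ℕ) (L : List ℕ) (U : ℕ → List ℕ) (rows : List Row) (al : List ATerm) : Bool :=
  dominated (normalize ((plusTerms L rows al).filter fun t => bucket nb t == b))
    (normalize ((minusTerms U rows al).filter fun t => bucket nb t == b))

/-! ## Semantics -/

/-- Value of a monomial at `x`. [folklore] -/
def evalM (x : ℕ → ℝ) (m : List ℕ) : ℝ := (m.map x).prod

/-- Value of a term list at `x`. [folklore] -/
def evalT (x : ℕ → ℝ) (l : List Term) : ℝ := (l.map fun t => (t.2 : ℝ) * evalM x t.1).sum

/-- Value of an event (sum of its cells). [folklore] -/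
def linEval (x : ℕ → ℝ) (e : List ℕ) : ℝ := (e.map x).sum

variable (x : ℕ → ℝ)

/-- `evalT` of a concatenation. [folklore] -/
theorem evalT_append (l l' : List Term) : evalT x (l ++ l') = evalT x l + evalT x l' := by
  simp [evalT, List.map_append, List.sum_append]

/-- `evalT` of a cons. [folklore] -/
theorem evalT_cons (t : Term) (l : List Term) : evalT x (t :: l) = (t.2 : ℝ) * evalM x t.1 + evalT x l := by
  simp [evalT]

/-- `evalT` of the empty list. [folklore] -/
@[simp] theorem evalT_nil : evalT x [] = 0 := by simp [evalT]

/-- `evalT` is invariant under permutations. [folklore] -/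
theorem evalT_perm {l l' : List Term} (h : l.Perm l') : evalT x l = evalT x l' :=
  (h.map _).sum_eq

/-- Monomials are nonnegative at nonnegative points. [folklore] -/
theorem evalM_nonneg (hx : ∀ i, 0 ≤ x i) (m : List ℕ) : 0 ≤ evalM x m :=
  List.prod_nonneg fun y hy => by
    obtain ⟨i, _, rfl⟩ := List.mem_map.1 hy
    exact hx i

/-- Term lists are nonnegative at nonnegative points. [folklore] -/
theorem evalT_nonneg (hx : ∀ i, 0 ≤ x i) (l : List Term) : 0 ≤ evalT x l :=
  List.sum_nonneg fun y hy => by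
    obtain ⟨t, _, rfl⟩ := List.mem_map.1 hy
    exact mul_nonneg (Nat.cast_nonneg _) (evalM_nonneg x hx _)

/-- Events are nonnegative at nonnegative points. [folklore] -/
theorem linEval_nonneg (hx : ∀ i, 0 ≤ x i) (e : List ℕ) : 0 ≤ linEval x e :=
  List.sum_nonneg fun y hy => by
    obtain ⟨i, _, rfl⟩ := List.mem_map.1 hy
    exact hx i

/-- Inserting a variable multiplies the monomial value. [folklore] -/
theorem evalM_monoIns (a : ℕ) (m : List ℕ) : evalM x (monoIns a m) = x a * evalM x m := by
  induction m with
  | nil => simp [monoIns, evalM]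
  | cons b l ih =>
    unfold monoIns
    cases Nat.ble a b
    · simp only [cond_false]
      unfold evalM at ih ⊢
      rw [List.map_cons, List.map_cons, List.prod_cons, List.prod_cons, ih]
      ring
    · simp [evalM]

/-! ### Permutation facts for the sort -/

/-- The split is a permutation. [folklore] -/
theorem perm_split (l : List Term) : ((split l).1 ++ (split l).2).Perm l := by
  induction l with
  | nil => simp [split]
  | cons t l ih =>
    show ((t :: (split l).2) ++ (split l).1).Perm (t :: l)
    rw [List.cons_append]
    exact (List.perm_append_comm.trans ih).cons t

/-- The fuelled merge is a permutation of the concatenation. [folklore] -/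
theorem perm_mergeF : ∀ (f : ℕ) (l₁ l₂ : List Term), (mergeF f l₁ l₂).Perm (l₁ ++ l₂)
  | 0, l₁, l₂ => by simp [mergeF]
  | _ + 1, [], l₂ => by simp [mergeF]
  | _ + 1, t₁ :: l₁, [] => by simp [mergeF]
  | f + 1, t₁ :: l₁, t₂ :: l₂ => by
    unfold mergeF
    cases monoLE t₁.1 t₂.1
    · simp only [cond_false]
      exact ((perm_mergeF f (t₁ :: l₁) l₂).cons t₂).trans List.perm_middle.symm
    · simp only [cond_true]
      exact (perm_mergeF f l₁ (t₂ :: l₂)).cons t₁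

/-- The fuelled merge sort is a permutation. [folklore] -/
theorem perm_msortF : ∀ (f : ℕ) (l : List Term), (msortF f l).Perm l
  | 0, l => by simp [msortF]
  | _ + 1, [] => by simp [msortF]
  | _ + 1, [t] => by simp [msortF]
  | f + 1, t :: t' :: l => by
    unfold msortF
    refine (perm_mergeF _ _ _).trans ?_
    exact ((perm_msortF f _).append (perm_msortF f _)).trans (perm_split (t :: t' :: l))

/-- Grouping preserves the value. [folklore] -/
theorem evalT_groupAux (c : Term) (l : List Term) : evalT x (groupAux c l) = evalT x (c :: l) := by
  induction l generalizing c with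
  | nil => simp [groupAux]
  | cons t l ih =>
    unfold groupAux
    by_cases h : c.1 = t.1
    · rw [decide_eq_true h, cond_true, ih, evalT_cons, evalT_cons, evalT_cons, h]
      push_cast
      ring
    · rw [decide_eq_false h, cond_false, evalT_cons, ih]
      simp only [evalT_cons]

/-- Grouping preserves the value. [folklore] -/
theorem evalT_group (l : List Term) : evalT x (group l) = evalT x l := by
  cases l with
  | nil => rfl
  | cons t l => exact evalT_groupAux x t l

/-- Normalisation preserves the value. [folklore] -/
theorem evalT_normalize (l : List Term) : evalT x (normalize l) = evalT x l := by
  unfold normalize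
  rw [evalT_group, evalT_perm x (perm_msortF _ _)]

/-! ### Domination -/

/-- What `dropTo` finds: the coefficient found plus the value of the tail is at most the value of the
list (the skipped terms are nonnegative). [folklore] -/
theorem dropTo_spec (hx : ∀ i, 0 ≤ x i) (m : List ℕ) :
    ∀ (g : List Term) (c : ℕ) (g' : List Term), dropTo m g = some (c, g') →
      (c : ℝ) * evalM x m + evalT x g' ≤ evalT x g
  | [], c, g', h => by simp [dropTo] at h
  | t :: l, c, g', h => by
    unfold dropTo at h
    by_cases htm : t.1 = m
    · rw [decide_eq_true htm, cond_true, Option.some.injEq, Prod.mk.injEq] at h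
      obtain ⟨rfl, rfl⟩ := h
      rw [evalT_cons, htm]
    · rw [decide_eq_false htm, cond_false] at h
      have ih := dropTo_spec hx m l c g' h
      rw [evalT_cons]
      have := mul_nonneg (Nat.cast_nonneg (α := ℝ) t.2) (evalM_nonneg x hx t.1)
      linarith

/-- **Domination is sound**: `dominated l g = true` and `x ≥ 0` give `evalT l ≤ evalT g`. [folklore] -/
theorem evalT_le_of_dominated (hx : ∀ i, 0 ≤ x i) :
    ∀ (l g : List Term), dominated l g = true → evalT x l ≤ evalT x g
  | [], g, _ => by simpa using evalT_nonneg x hx g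
  | t :: l, g, h => by
    unfold dominated at h
    cases hd : dropTo t.1 g with
    | none =>
      rw [hd] at h
      simp only [Bool.and_eq_true, Nat.beq_eq] at h
      have ih := evalT_le_of_dominated hx l g h.2
      rw [evalT_cons, h.1]
      push_cast
      linarith
    | some p =>
      obtain ⟨c, g'⟩ := p
      rw [hd] at h
      simp only [Bool.and_eq_true, Nat.ble_eq] at h
      have ih := evalT_le_of_dominated hx l g' h.2
      have hdrop := dropTo_spec x hx t.1 g c g' hd
      rw [evalT_cons]
      have hm := evalM_nonneg x hx t.1
      have hc : (t.2 : ℝ) ≤ c := by exact_mod_cast h.1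
      nlinarith

end CertCheck

end Summit.CriticalPhenomena.PercolationContinuityZ3.Theorems
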